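import Literature.NumberTheory.EllipticCurves.Szpiro
import Literature.NumberTheory.EllipticCurves.SzpiroLocalDataProofs
import Literature.NumberTheory.DiophantineGeometry.StrongHall
import HarnessLib

/-!
# Generalized Szpiro ⟹ abc via the Frey curve (Bombieri–Gubler 12.5.10, Theorem 12.5.12 (c) ⟹ (a))

Trunk: `DiophValNum` (family `abc`; companion proof file of
`Literature.NumberTheory.EllipticCurves.Szpiro`). Vendors and proves, from E. Bombieri, W. Gubler,
*Heights in Diophantine Geometry* (2006):

* `Literature.NumberTheory.EllipticCurves.freyIntModel`, `Literature.NumberTheory.EllipticCurves.freyIntModel₂` — the integral equations **(12.17)**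
  `y² = x³ + (B − A) x² − AB x` and **(12.18)** `y² + xy = x³ + ((B − A − 1)/4) x² − (AB/16) x` of
  the Frey curve (`freyIntModel A B ⊗ ℚ = freyCurve A B` of `Szpiro`), with their `c₄` and `Δ`
  (**Example 12.5.10**);
* **Example 12.5.10**, proved: (12.17) is a global minimal equation if `16 ∤ AB(A+B)`
  (`isMinimalAt_freyIntModel`) with `cond ∣ 2¹⁰ rad (AB(A+B))` (`conductorNorm_freyIntModel_dvd`:
  `f₂ ≤ v₂(Δ) ≤ 10`, multiplicative reduction at odd `p ∣ AB(A+B)`); (12.18) is a global minimal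
  equation for `A ≡ −1 (mod 4)`, `16 ∣ B` (`isMinimalAt_freyIntModel₂`) with multiplicative
  reduction at every bad prime, `cond ∣ rad (AB(A+B))` (`conductorNorm_freyIntModel₂_dvd`);
* `Literature.NumberTheory.EllipticCurves.abcLe_of_generalizedSzpiroBG` — **Theorem 12.5.12, (c) ⟹ (a)**, proved: the generalized
  Szpiro conjecture 12.5.11 (`GeneralizedSzpiroConjectureBG`) implies the strong abc-conjecture over
  `ℚ` in the printed `≤`-form of 12.2.2 over Wave0's `IsABCTriple` / `rad`.

## Design notes

* Sign conventions: `Szpiro.freyCurve a b` is `y² = x (x − a) (x + b)`; B–G's `y² = x (x + a)(x − b)`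
  is `freyCurve b a`. The arrangement "`a ≡ 1 (mod 4)`, `16 ∣ b`" of B–G becomes
  `A ≡ −1 (mod 4)`, `16 ∣ B` here (Serre's normalisation, as in the docstrings of `Szpiro`);
  `Literature.NumberTheory.EllipticCurves.exists_arrangement` produces it from any abc triple with `16 ∣ abc`.
* Reduction types and conductor exponents are read off from the explicit minimal equations through
  `Literature.NumberTheory.EllipticCurves.SzpiroLocalDataProofs` (all facts discharged); in
  particular the crude bound `f₂ ≤ v₂(Δ_min)` replaces any appeal to `f₂ ≤ 8`.
* This file proves what Theorem 12.5.12 needs for the integral models; the `Szpiro` named facts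
  about `freyCurve` itself (`isSemistableAt_freyCurve`, `isSemistable_freyCurve_of_mod`,
  `conductorNorm_freyCurve_of_mod`, `minimalDiscriminantNorm_freyCurve_of_mod`) are discharged from
  it in the sibling `SzpiroFreyCurveProofs` (not `conductorNorm_freyCurve_dvd`, which needs
  `f₂ ≤ 8`).

## References

* E. Bombieri, W. Gubler, *Heights in Diophantine Geometry*, New Math. Monogr. 4, Cambridge Univ.
  Press 2006, Example 12.5.10 ((12.17), (12.18)), Theorem 12.5.12, proof (c) ⟹ (a), pp. 429–433.
  [BombieriGubler2006]
* G. Frey, *Links between stable elliptic curves and certain Diophantine equations*, Ann. Univ.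
  Sarav. Ser. Math. 1 (1986). [Frey1986]
-/

noncomputable section

open UniqueFactorizationMonoid IsDedekindDomain Real WeierstrassCurve Rat.HeightOneSpectrum

namespace Literature.NumberTheory.EllipticCurves

/-! ### The two integral models of the Frey curve (B–G (12.17), (12.18)) -/

/-- **B–G (12.17)**: the integral Weierstrass model `y² = x³ + (B − A) x² − AB x` over `ℤ` of the
Frey curve `y² = x (x − A) (x + B)` (`= freyCurve A B` after base change to `ℚ`; B–G write
`y² = x (x + a) (x − b)`, i.e. `(a, b) = (B, A)`). [cite: BombieriGubler2006, Ex. 12.5.10 (12.17)] -/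
def freyIntModel (A B : ℤ) : WeierstrassCurve ℤ :=
  ⟨0, B - A, 0, -(A * B), 0⟩

/-- **B–G (12.18)**: for `A ≡ −1 (mod 4)`, `16 ∣ B` the substitution `x = 4x'`, `y = 8y' + 4x'`
turns (12.17) into the integral model `y'² + x'y' = x'³ + ((B − A − 1)/4) x'² − (AB/16) x'`
(Serre's normalisation; B–G Ex. 12.5.10, case (a), with `(a, b) = (B, A)` up to the sign
conventions recorded at `freyIntModel`). The divisions are exact under the stated congruences
(`ℤ`-division otherwise). [cite: BombieriGubler2006, Ex. 12.5.10 (12.18)] -/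
def freyIntModel₂ (A B : ℤ) : WeierstrassCurve ℤ :=
  ⟨1, (B - A - 1) / 4, 0, -(A * B / 16), 0⟩

/-- `freyIntModel A B ⊗ ℚ` is the Frey curve `freyCurve A B` of `Szpiro`. [folklore] -/
theorem baseChange_freyIntModel (A B : ℤ) : (freyIntModel A B).baseChange ℚ = freyCurve A B := by
  ext <;> simp [freyIntModel, freyCurve, baseChange]

/-- `c₄` of (12.17): `c₄ = 16 (A² + AB + B²)` (B–G 12.5.10). [cite: BombieriGubler2006, Ex. 12.5.10] -/
theorem freyIntModel_c₄ (A B : ℤ) : (freyIntModel A B).c₄ = 16 * (A ^ 2 + A * B + B ^ 2) := by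
  simp only [freyIntModel, WeierstrassCurve.c₄, WeierstrassCurve.b₂, WeierstrassCurve.b₄]
  ring

/-- `Δ` of (12.17): `Δ = 16 (AB(A+B))²` (B–G 12.5.10). [cite: BombieriGubler2006, Ex. 12.5.10] -/
theorem freyIntModel_Δ (A B : ℤ) : (freyIntModel A B).Δ = 16 * (A * B * (A + B)) ^ 2 := by
  simp only [freyIntModel, WeierstrassCurve.Δ, WeierstrassCurve.b₂, WeierstrassCurve.b₄,
    WeierstrassCurve.b₆, WeierstrassCurve.b₈]
  ring

/-- `c₄` of (12.18): `c₄' = A² + AB + B²` (B–G 12.5.10 (a)), under `4 ∣ B − A − 1`, `16 ∣ AB`.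
[cite: BombieriGubler2006, Ex. 12.5.10] -/
theorem freyIntModel₂_c₄ {A B : ℤ} (h4 : 4 ∣ B - A - 1) (h16 : 16 ∣ A * B) :
    (freyIntModel₂ A B).c₄ = A ^ 2 + A * B + B ^ 2 := by
  obtain ⟨d, hd⟩ := h4
  obtain ⟨e, he⟩ := h16
  have hd' : (B - A - 1) / 4 = d := by rw [hd]; simp
  have he' : A * B / 16 = e := by rw [he]; simp
  simp only [freyIntModel₂, WeierstrassCurve.c₄, WeierstrassCurve.b₂, WeierstrassCurve.b₄, hd', he']
  linear_combination (-(1 + 4 * d + B - A)) * hd - 3 * he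

/-- `Δ` of (12.18): `Δ' = 2⁻⁸ (AB(A+B))²`, i.e. `Δ' = (AB/16)² (A + B)²` (B–G 12.5.10 (a)), under
`4 ∣ B − A − 1`, `16 ∣ AB`. [cite: BombieriGubler2006, Ex. 12.5.10] -/
theorem freyIntModel₂_Δ {A B : ℤ} (h4 : 4 ∣ B - A - 1) (h16 : 16 ∣ A * B) :
    (freyIntModel₂ A B).Δ = (A * B / 16) ^ 2 * (A + B) ^ 2 := by
  obtain ⟨d, hd⟩ := h4
  obtain ⟨e, he⟩ := h16
  have hd' : (B - A - 1) / 4 = d := by rw [hd]; simp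
  have he' : A * B / 16 = e := by rw [he]; simp
  simp only [freyIntModel₂, WeierstrassCurve.Δ, WeierstrassCurve.b₂, WeierstrassCurve.b₄,
    WeierstrassCurve.b₆, WeierstrassCurve.b₈, hd', he']
  have hBA : B - A = 4 * d + 1 := by linear_combination hd
  have hAB : A * B = 16 * e := he
  -- `Δ = e² ((B − A)² + 4AB) = e² (A + B)²`
  have : (A + B) ^ 2 = (4 * d + 1) ^ 2 + 4 * (16 * e) := by
    rw [← hBA, ← hAB]; ring
  rw [this]
  ring


/-! ### Coprimality: the primes of `AB(A+B)` do not divide `A² + AB + B²` -/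

/-- For coprime `A, B`, a prime dividing `AB(A + B)` does not divide `A² + AB + B²`
(B–G 12.5.10: "a prime number `p ≠ 2` divides at most one of `c₄`, `Δ`"; the argument works for
every prime, the factor `16` of `c₄ = 16 (A² + AB + B²)` aside). [cite: BombieriGubler2006, Ex. 12.5.10] -/
theorem not_dvd_sq_add_mul_add_sq {A B : ℤ} (hAB : IsCoprime A B) {p : ℕ} (hp : p.Prime)
    (h : (p : ℤ) ∣ A * B * (A + B)) : ¬ (p : ℤ) ∣ A ^ 2 + A * B + B ^ 2 := by
  intro hc
  have hpint : Prime (p : ℤ) := Nat.prime_iff_prime_int.mp hp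
  have hnot : ¬ ((p : ℤ) ∣ A ∧ (p : ℤ) ∣ B) := by
    rintro ⟨⟨a, rfl⟩, ⟨b, rfl⟩⟩
    have := hAB.isUnit_of_dvd' (dvd_mul_right _ a) (dvd_mul_right _ b)
    exact hpint.not_unit this
  apply hnot
  rcases hpint.dvd_or_dvd h with h | h
  · rcases hpint.dvd_or_dvd h with hA | hB
    · refine ⟨hA, hpint.dvd_of_dvd_pow (n := 2) ?_⟩
      have : B ^ 2 = (A ^ 2 + A * B + B ^ 2) - A * (A + B) := by ring
      rw [this]; exact dvd_sub hc (dvd_mul_of_dvd_left hA _)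
    · refine ⟨hpint.dvd_of_dvd_pow (n := 2) ?_, hB⟩
      have : A ^ 2 = (A ^ 2 + A * B + B ^ 2) - B * (A + B) := by ring
      rw [this]; exact dvd_sub hc (dvd_mul_of_dvd_left hB _)
  · have hAB' : (p : ℤ) ∣ A * B := by
      have : A * B = (A + B) ^ 2 - (A ^ 2 + A * B + B ^ 2) := by ring
      rw [this]; exact dvd_sub (dvd_pow h two_ne_zero) hc
    rcases hpint.dvd_or_dvd hAB' with hA | hB
    · exact ⟨hA, by simpa using dvd_sub h hA⟩
    · exact ⟨by simpa using dvd_sub h hB, hB⟩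

/-- `ord₂`-bookkeeping for (12.17): if `16 ∤ m` then `2¹¹ ∤ 16 m²` (B–G 12.5.10: "if `p = 2` and
`16 ∤ abc`, then `2¹¹ ∤ Δ`"). [cite: BombieriGubler2006, Ex. 12.5.10] -/
theorem not_two_pow_eleven_dvd {m : ℤ} (hm : m ≠ 0) (h16 : ¬ (16 : ℤ) ∣ m) :
    ¬ (2 : ℤ) ^ 11 ∣ 16 * m ^ 2 := by
  intro h
  set n := m.natAbs with hn
  have hn0 : n ≠ 0 := Int.natAbs_ne_zero.mpr hm
  have hlt : n.factorization 2 < 4 := by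
    by_contra hle
    push Not at hle
    apply h16
    have : 2 ^ 4 ∣ n := (Nat.prime_two.pow_dvd_iff_le_factorization hn0).mpr hle
    have := Int.natCast_dvd.mpr this
    simpa using this
  have h' : 2 ^ 11 ∣ 16 * n ^ 2 := by
    have := Int.natCast_dvd.mp (show ((2 ^ 11 : ℕ) : ℤ) ∣ 16 * m ^ 2 by exact_mod_cast h)
    simpa [Int.natAbs_mul, Int.natAbs_pow] using this
  have hle := (Nat.prime_two.pow_dvd_iff_le_factorization (by positivity)).mp h'
  rw [show (16 : ℕ) = 2 ^ 4 by norm_num, Nat.factorization_mul (by positivity) (by positivity),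
    Nat.factorization_pow, Nat.factorization_pow, Finsupp.add_apply] at hle
  simp [Nat.prime_two.factorization_self] at hle
  omega

/-! ### B–G Example 12.5.10: minimality and conductor of the two models -/

section Models

variable {A B : ℤ}

/-- (12.17) is an elliptic curve when `AB(A+B) ≠ 0`. [folklore] -/
theorem isElliptic_freyIntModel (h0 : A * B * (A + B) ≠ 0) :
    ((freyIntModel A B).baseChange ℚ).IsElliptic := by
  rw [baseChange_freyIntModel]; exact isElliptic_freyCurve h0

/-- **B–G 12.5.10**, first case: if `16 ∤ AB(A+B)` (and `A, B` coprime, `AB(A+B) ≠ 0`) then (12.17)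
is a global minimal Weierstrass equation: at odd `p` it divides at most one of `c₄`, `Δ`; at
`p = 2`, `2¹¹ ∤ Δ`. [cite: BombieriGubler2006, Ex. 12.5.10] -/
theorem isMinimalAt_freyIntModel (hAB : IsCoprime A B) (h0 : A * B * (A + B) ≠ 0)
    (h16 : ¬ (16 : ℤ) ∣ A * B * (A + B)) (v : HeightOneSpectrum ℤ) :
    ((freyIntModel A B).baseChange ℚ).IsMinimalAt v := by
  set p := natGenerator v with hp
  have hpp : p.Prime := prime_natGenerator v
  by_cases hpm : (p : ℤ) ∣ A * B * (A + B)
  · by_cases h2 : p = 2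
    · -- `p = 2`: `2¹¹ ∤ Δ`, a fortiori `2¹² ∤ Δ`
      refine isMinimalAt_baseChange_int_of_not_pow_dvd_Δ ?_
      rw [← hp, h2, freyIntModel_Δ]
      intro h
      have h' : (2 : ℤ) ^ 12 ∣ 16 * (A * B * (A + B)) ^ 2 := by exact_mod_cast h
      exact not_two_pow_eleven_dvd h0 h16 (dvd_trans (pow_dvd_pow 2 (by norm_num : 11 ≤ 12)) h')
    · -- odd `p ∣ AB(A+B)`: `p ∤ c₄ = 16 (A² + AB + B²)`
      refine isMinimalAt_baseChange_int_of_not_dvd_c₄ ?_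
      rw [← hp, freyIntModel_c₄]
      intro h
      have hpint : Prime (p : ℤ) := Nat.prime_iff_prime_int.mp hpp
      rcases hpint.dvd_or_dvd h with h | h
      · have : (p : ℤ) ∣ 2 ^ 4 := by simpa using h
        have := Int.natCast_dvd_natCast.mp (by exact_mod_cast hpint.dvd_of_dvd_pow this : (p : ℤ) ∣ (2 : ℕ))
        exact h2 ((Nat.prime_dvd_prime_iff_eq hpp Nat.prime_two).mp this)
      · exact not_dvd_sq_add_mul_add_sq hAB hpp hpm h
  · -- `p ∤ AB(A+B)`: then `p ∤ Δ = 16 (AB(A+B))²` (for `p = 2` note `2 ∣ AB(A+B)` is automatic… but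
    -- we only need `p¹² ∤ Δ`, which holds as `p¹² ∣ 16 m²` forces `p ∣ m`)
    refine isMinimalAt_baseChange_int_of_not_pow_dvd_Δ ?_
    rw [← hp, freyIntModel_Δ]
    intro h
    have hpint : Prime (p : ℤ) := Nat.prime_iff_prime_int.mp hpp
    have h5 : (p : ℤ) ^ 5 ∣ 16 * (A * B * (A + B)) ^ 2 := dvd_trans (pow_dvd_pow _ (by norm_num)) h
    -- `p⁵ ∣ 16 m²` with `p ∤ m` is impossible: `p ∣ 16 m²` gives `p ∣ 16`, so `p = 2`, and `2⁵ ∤ 16`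
    have hp16 : (p : ℤ) ∣ 16 := by
      rcases hpint.dvd_or_dvd (dvd_trans (dvd_pow_self _ (by norm_num)) h5) with h | h
      · exact h
      · exact absurd (hpint.dvd_of_dvd_pow h) hpm
    have hp2 : p = 2 := by
      have : (p : ℤ) ∣ 2 ^ 4 := by simpa using hp16
      have := Int.natCast_dvd_natCast.mp (by exact_mod_cast hpint.dvd_of_dvd_pow this : (p : ℤ) ∣ (2 : ℕ))
      exact (Nat.prime_dvd_prime_iff_eq hpp Nat.prime_two).mp this
    apply hpm
    rw [hp2]
    -- `2 ∣ AB(A+B)` always fails? No: deduce it from `2⁵ ∣ 16 m²`: `2 ∣ m²`, so `2 ∣ m`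
    rw [hp2] at h5
    have h5' : (16 : ℤ) * 2 ∣ 16 * (A * B * (A + B)) ^ 2 := by
      have : ((2 : ℕ) : ℤ) ^ 5 = 16 * 2 := by norm_num
      rwa [this] at h5
    have h2m : (2 : ℤ) ∣ (A * B * (A + B)) ^ 2 :=
      (mul_dvd_mul_iff_left (by norm_num : (16 : ℤ) ≠ 0)).mp h5'
    exact_mod_cast Int.prime_two.dvd_of_dvd_pow h2m


/-- The place of `ℤ` above a rational prime, with its generator. [folklore] -/
theorem exists_place (p : Nat.Primes) : ∃ v : HeightOneSpectrum ℤ, natGenerator v = p :=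
  ⟨(primesEquiv (R := ℤ)).symm p, Literature.NumberTheory.EllipticCurves.Rat.natGenerator_primesEquiv_symm p⟩

/-- An odd prime does not divide `16`; a prime dividing `16` is `2`. [folklore] -/
theorem eq_two_of_dvd_sixteen {p : ℕ} (hp : p.Prime) (h : (p : ℤ) ∣ 16) : p = 2 := by
  have hpint : Prime (p : ℤ) := Nat.prime_iff_prime_int.mp hp
  have : (p : ℤ) ∣ 2 ^ 4 := by simpa using h
  have := Int.natCast_dvd_natCast.mp (by exact_mod_cast hpint.dvd_of_dvd_pow this : (p : ℤ) ∣ (2 : ℕ))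
  exact (Nat.prime_dvd_prime_iff_eq hp Nat.prime_two).mp this

/-- **B–G 12.5.10**, conductor in the first case: `cond (E) < 16³ ∏_{p ∣ abc, p ≠ 2} p`; precisely
`f₂ ≤ v₂(Δ) ≤ 10`, `f_p = 1` at odd `p ∣ AB(A+B)` (multiplicative reduction: `p ∣ Δ`, `p ∤ c₄`),
`f_p = 0` otherwise, so that `N ∣ 2¹⁰ rad (AB(A+B))`. [cite: BombieriGubler2006, Ex. 12.5.10] -/
theorem conductorNorm_freyIntModel_dvd (hAB : IsCoprime A B) (h0 : A * B * (A + B) ≠ 0)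
    (h16 : ¬ (16 : ℤ) ∣ A * B * (A + B)) :
    ((freyIntModel A B).baseChange ℚ).conductorNorm ℤ ∣ 2 ^ 10 * radical (A * B * (A + B)).natAbs := by
  haveI := isElliptic_freyIntModel h0
  set m := A * B * (A + B) with hm
  have hm0 : m.natAbs ≠ 0 := Int.natAbs_ne_zero.mpr h0
  refine conductorNorm_dvd_of_forall_conductorExponent_le _
    (mul_ne_zero (by positivity) radical_ne_zero) fun p ↦ ?_
  obtain ⟨v, hv⟩ := exists_place p
  obtain ⟨p, hp⟩ := p
  simp only at hv ⊢
  have hmin := isMinimalAt_freyIntModel hAB h0 h16 v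
  have hpint : Prime (p : ℤ) := Nat.prime_iff_prime_int.mp hp
  rw [show (primesEquiv (R := ℤ)).symm ⟨p, hp⟩ = v from
      (primesEquiv (R := ℤ)).symm_apply_eq.mpr (Subtype.ext hv.symm),
    Nat.factorization_mul (by positivity) radical_ne_zero, Finsupp.add_apply,
    DiophantineGeometry.factorization_radical_apply hm0 hp, Nat.Prime.factorization_pow Nat.prime_two,
    Finsupp.single_apply]
  by_cases h2 : p = 2
  · subst h2
    have : ((freyIntModel A B).baseChange ℚ).conductorExponent v < 11 := by
      refine conductorExponent_lt_of_not_pow_dvd hmin ?_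
      rw [hv, freyIntModel_Δ]
      exact_mod_cast not_two_pow_eleven_dvd h0 h16
    rw [if_pos rfl]; omega
  rw [if_neg (Ne.symm h2), zero_add]
  by_cases hpm : (p : ℤ) ∣ m
  · rw [if_pos (Int.natCast_dvd.mp hpm)]
    refine (conductorExponent_eq_one_of_dvd_Δ_of_not_dvd_c₄ hmin ?_ ?_).le
    · rw [hv, freyIntModel_Δ]
      exact dvd_mul_of_dvd_right (dvd_pow hpm two_ne_zero) _
    · rw [hv, freyIntModel_c₄]
      intro h
      rcases hpint.dvd_or_dvd h with h | h
      · exact h2 (eq_two_of_dvd_sixteen hp h)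
      · exact not_dvd_sq_add_mul_add_sq hAB hp hpm h
  · rw [if_neg (mt Int.natCast_dvd.mpr hpm)]
    refine (conductorExponent_eq_zero_of_not_dvd_Δ hmin ?_).le
    rw [hv, freyIntModel_Δ]
    intro h
    rcases hpint.dvd_or_dvd h with h | h
    · exact h2 (eq_two_of_dvd_sixteen hp h)
    · exact hpm (hpint.dvd_of_dvd_pow h)

/-- (12.18) is an elliptic curve when `AB(A+B) ≠ 0` (`16 ∣ AB`). [folklore] -/
theorem isElliptic_freyIntModel₂ (h0 : A * B * (A + B) ≠ 0) (h4 : 4 ∣ B - A - 1)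
    (h16 : 16 ∣ A * B) : ((freyIntModel₂ A B).baseChange ℚ).IsElliptic := by
  refine ⟨?_⟩
  rw [baseChange_int_Δ, freyIntModel₂_Δ h4 h16, isUnit_iff_ne_zero]
  obtain ⟨e, he⟩ := h16
  have he' : A * B / 16 = e := by rw [he]; simp
  rw [he']
  have he0 : e ≠ 0 := by
    rintro rfl
    apply h0
    rw [he]; ring
  have hAB0 : A + B ≠ 0 := fun h ↦ h0 (by rw [h, mul_zero])
  exact_mod_cast mul_ne_zero (pow_ne_zero 2 he0) (pow_ne_zero 2 hAB0)

/-- A prime dividing `Δ' = (AB/16)² (A+B)²` divides `AB(A+B)`. [folklore] -/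
theorem dvd_of_dvd_freyIntModel₂_Δ (h4 : 4 ∣ B - A - 1) (h16 : 16 ∣ A * B) {p : ℕ} (hp : p.Prime)
    (h : (p : ℤ) ∣ (freyIntModel₂ A B).Δ) : (p : ℤ) ∣ A * B * (A + B) := by
  have hpint : Prime (p : ℤ) := Nat.prime_iff_prime_int.mp hp
  rw [freyIntModel₂_Δ h4 h16] at h
  obtain ⟨e, he⟩ := h16
  have he' : A * B / 16 = e := by rw [he]; simp
  rw [he'] at h
  rcases hpint.dvd_or_dvd h with h | h
  · have : (p : ℤ) ∣ A * B := by rw [he]; exact dvd_mul_of_dvd_right (hpint.dvd_of_dvd_pow h) _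
    exact dvd_mul_of_dvd_left this _
  · exact dvd_mul_of_dvd_right (hpint.dvd_of_dvd_pow h) _

/-- **B–G 12.5.10 (a)**: for `A ≡ −1 (mod 4)`, `16 ∣ B` (and `A, B` coprime, `AB(A+B) ≠ 0`),
(12.18) is a global minimal Weierstrass equation: `c₄' = A² + AB + B²` is odd, so (12.18) is
minimal at `2`; at odd `p` it divides at most one of `c₄'`, `Δ'`. [cite: BombieriGubler2006, Ex. 12.5.10] -/
theorem isMinimalAt_freyIntModel₂ (hAB : IsCoprime A B)
    (hA : 4 ∣ A + 1) (hB : 16 ∣ B) (v : HeightOneSpectrum ℤ) :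
    ((freyIntModel₂ A B).baseChange ℚ).IsMinimalAt v := by
  have h4 : 4 ∣ B - A - 1 := by
    have : B - A - 1 = B - (A + 1) := by ring
    rw [this]; exact dvd_sub (dvd_trans (by norm_num) hB) hA
  have h16 : 16 ∣ A * B := dvd_mul_of_dvd_right hB _
  set p := natGenerator v with hp
  have hpp : p.Prime := prime_natGenerator v
  by_cases hpm : (p : ℤ) ∣ A * B * (A + B)
  · refine isMinimalAt_baseChange_int_of_not_dvd_c₄ ?_
    rw [← hp, freyIntModel₂_c₄ h4 h16]
    exact not_dvd_sq_add_mul_add_sq hAB hpp hpm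
  · refine isMinimalAt_baseChange_int_of_not_pow_dvd_Δ ?_
    rw [← hp]
    intro h
    exact hpm (dvd_of_dvd_freyIntModel₂_Δ h4 h16 hpp (dvd_trans (dvd_pow_self _ (by norm_num)) h))

/-- **B–G 12.5.10 (a)**, conductor in the second case: "`E` has multiplicative reduction at all
primes `p ∣ Δ`", so `cond (E) = rad (Δ) ≤ ∏_{p ∣ abc} p`: here `N ∣ rad (AB(A+B))`.
[cite: BombieriGubler2006, Ex. 12.5.10] -/
theorem conductorNorm_freyIntModel₂_dvd (hAB : IsCoprime A B) (h0 : A * B * (A + B) ≠ 0)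
    (hA : 4 ∣ A + 1) (hB : 16 ∣ B) :
    ((freyIntModel₂ A B).baseChange ℚ).conductorNorm ℤ ∣ radical (A * B * (A + B)).natAbs := by
  have h4 : 4 ∣ B - A - 1 := by
    have : B - A - 1 = B - (A + 1) := by ring
    rw [this]; exact dvd_sub (dvd_trans (by norm_num) hB) hA
  have h16 : 16 ∣ A * B := dvd_mul_of_dvd_right hB _
  haveI := isElliptic_freyIntModel₂ h0 h4 h16
  set m := A * B * (A + B) with hm
  have hm0 : m.natAbs ≠ 0 := Int.natAbs_ne_zero.mpr h0
  refine conductorNorm_dvd_of_forall_conductorExponent_le _ radical_ne_zero fun p ↦ ?_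
  obtain ⟨v, hv⟩ := exists_place p
  obtain ⟨p, hp⟩ := p
  simp only at hv ⊢
  have hmin := isMinimalAt_freyIntModel₂ hAB hA hB v
  rw [show (primesEquiv (R := ℤ)).symm ⟨p, hp⟩ = v from
      (primesEquiv (R := ℤ)).symm_apply_eq.mpr (Subtype.ext hv.symm),
    DiophantineGeometry.factorization_radical_apply hm0 hp]
  by_cases hpm : (p : ℤ) ∣ m
  · rw [if_pos (Int.natCast_dvd.mp hpm)]
    have hc₄ : ¬ (natGenerator v : ℤ) ∣ (freyIntModel₂ A B).c₄ := by
      rw [hv, freyIntModel₂_c₄ h4 h16]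
      exact not_dvd_sq_add_mul_add_sq hAB hp hpm
    by_cases hΔ : (natGenerator v : ℤ) ∣ (freyIntModel₂ A B).Δ
    · exact (conductorExponent_eq_one_of_dvd_Δ_of_not_dvd_c₄ hmin hΔ hc₄).le
    · exact (conductorExponent_eq_zero_of_not_dvd_Δ hmin hΔ).trans_le zero_le_one
  · rw [if_neg (mt Int.natCast_dvd.mpr hpm)]
    refine (conductorExponent_eq_zero_of_not_dvd_Δ hmin ?_).le
    rw [hv]
    exact fun h ↦ hpm (dvd_of_dvd_freyIntModel₂_Δ h4 h16 hp h)

end Models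

/-! ### B–G 12.5.10 / proof of 12.5.12 (c) ⟹ (a): the arrangement `A ≡ −1 (mod 4)`, `16 ∣ B` -/

/-- **B–G, proof of 12.5.12 (c) ⟹ (a)** ("we assume `16 ∣ abc`. By permuting `a, b, c`, we may
assume `a ≡ 1 (mod 4)` and `b ≡ 0 (mod 16)`"; Ex. 12.5.10: "we are free to replace `a` by `−c`
and `c` by `−a`"): an abc triple with `16 ∣ abc` admits a signed arrangement `(A, B, A + B)` of
`{±a, ±b, ±c}` with `A ≡ −1 (mod 4)`, `16 ∣ B`, `A, B` coprime, `|AB(A+B)| = abc` and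
`2 (A² + AB + B²) = a² + b² + c²` (sign conventions of `freyIntModel`).
[cite: BombieriGubler2006, Thm. 12.5.12 (c) ⟹ (a)] -/
theorem exists_arrangement {a b c : ℕ} (h : DiophantineGeometry.IsABCTriple a b c) (h16 : 16 ∣ a * b * c) :
    ∃ A B : ℤ, IsCoprime A B ∧ 4 ∣ A + 1 ∧ (16 : ℤ) ∣ B ∧
      (A * B * (A + B)).natAbs = a * b * c ∧
      2 * (A ^ 2 + A * B + B ^ 2) = (a : ℤ) ^ 2 + (b : ℤ) ^ 2 + (c : ℤ) ^ 2 := by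
  obtain ⟨ha, hb, habc, hcop⟩ := h
  have hab : IsCoprime (a : ℤ) (b : ℤ) := Nat.isCoprime_iff_coprime.mpr hcop
  have hac : IsCoprime (a : ℤ) (c : ℤ) := by
    have : (c : ℤ) = a + b := by rw [← habc]; push_cast; ring
    rw [this]
    exact Nat.isCoprime_iff_coprime.mpr (Nat.coprime_self_add_right.mpr hcop)
  have hbc : IsCoprime (b : ℤ) (c : ℤ) := by
    have : (c : ℤ) = b + a := by rw [← habc]; push_cast; ring
    rw [this]
    exact Nat.isCoprime_iff_coprime.mpr (Nat.coprime_self_add_right.mpr hcop.symm)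
  have hP : ((a * b * c : ℕ) : ℤ) = a * b * (a + b) := by rw [← habc]; push_cast; ring
  have hQ : (a : ℤ) ^ 2 + (b : ℤ) ^ 2 + (c : ℤ) ^ 2 = 2 * (a ^ 2 + a * b + b ^ 2) := by
    rw [← habc]; push_cast; ring
  -- parity: exactly one of `a, b, c` is even, and it is divisible by `16`
  have hodd2 : ¬ (2 ∣ a ∧ 2 ∣ b) := by
    rintro ⟨h2a, h2b⟩
    have := Nat.dvd_gcd h2a h2b
    rw [hcop.gcd_eq_one] at this
    omega
  rcases Nat.even_or_odd a with ha2 | ha2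
  · -- `a` even, `b` and `c` odd, `16 ∣ a`
    have hb2 : Odd b := Nat.odd_iff.mpr (by rcases ha2 with ⟨k, hk⟩; omega)
    have hc2 : Odd c := by rw [← habc]; exact ha2.add_odd hb2
    have h16a : 16 ∣ a := by
      have hco : Nat.Coprime 16 (b * c) := by
        rw [show (16 : ℕ) = 2 ^ 4 by norm_num]
        exact Nat.Coprime.pow_left 4 (Nat.coprime_two_left.mpr (hb2.mul hc2))
      exact hco.dvd_of_dvd_mul_right (by simpa [mul_assoc] using h16)
    rcases (show b % 4 = 1 ∨ b % 4 = 3 by rcases hb2 with ⟨k, rfl⟩; omega) with hb4 | hb4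
    · refine ⟨-b, -a, hab.symm.neg_left.neg_right, by omega, by omega, ?_, by linear_combination -hQ⟩
      rw [show (-(b : ℤ)) * (-(a : ℤ)) * (-b + -a) = -((a * b * c : ℕ) : ℤ) by rw [hP]; ring,
        Int.natAbs_neg, Int.natAbs_natCast]
    · refine ⟨b, a, hab.symm, by omega, by omega, ?_, by linear_combination -hQ⟩
      rw [show (b : ℤ) * a * (b + a) = ((a * b * c : ℕ) : ℤ) by rw [hP]; ring, Int.natAbs_natCast]
  rcases Nat.even_or_odd b with hb2 | hb2
  · -- `b` even, `a` and `c` odd, `16 ∣ b`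
    have hc2 : Odd c := by rw [← habc]; exact ha2.add_even hb2
    have h16b : 16 ∣ b := by
      have hco : Nat.Coprime 16 (a * c) := by
        rw [show (16 : ℕ) = 2 ^ 4 by norm_num]
        exact Nat.Coprime.pow_left 4 (Nat.coprime_two_left.mpr (ha2.mul hc2))
      refine hco.dvd_of_dvd_mul_left (by simpa [mul_comm, mul_assoc, mul_left_comm] using h16)
    rcases (show a % 4 = 1 ∨ a % 4 = 3 by rcases ha2 with ⟨k, rfl⟩; omega) with ha4 | ha4
    · refine ⟨-a, -b, hab.neg_left.neg_right, by omega, by omega, ?_, by linear_combination -hQ⟩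
      rw [show (-(a : ℤ)) * (-(b : ℤ)) * (-a + -b) = -((a * b * c : ℕ) : ℤ) by rw [hP]; ring,
        Int.natAbs_neg, Int.natAbs_natCast]
    · refine ⟨a, b, hab, by omega, by omega, ?_, by linear_combination -hQ⟩
      rw [show (a : ℤ) * b * (a + b) = ((a * b * c : ℕ) : ℤ) by rw [hP], Int.natAbs_natCast]
  · -- `a`, `b` odd, `c` even, `16 ∣ c`
    have hc2 : Even c := by rw [← habc]; exact ha2.add_odd hb2
    have h16c : 16 ∣ c := by
      have hco : Nat.Coprime 16 (a * b) := by
        rw [show (16 : ℕ) = 2 ^ 4 by norm_num]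
        exact Nat.Coprime.pow_left 4 (Nat.coprime_two_left.mpr (ha2.mul hb2))
      exact hco.dvd_of_dvd_mul_left h16
    have hc' : (c : ℤ) = a + b := by rw [← habc]; push_cast; ring
    rcases (show a % 4 = 1 ∨ a % 4 = 3 by rcases ha2 with ⟨k, rfl⟩; omega) with ha4 | ha4
    · refine ⟨-a, c, hac.neg_left, by omega, by omega, ?_, ?_⟩
      · rw [show (-(a : ℤ)) * c * (-a + c) = -((a * b * c : ℕ) : ℤ) by rw [hP, hc']; ring,
          Int.natAbs_neg, Int.natAbs_natCast]
      · rw [hQ, hc']; ring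
    · refine ⟨a, -c, hac.neg_right, by omega, by omega, ?_, ?_⟩
      · rw [show (a : ℤ) * (-(c : ℤ)) * (a + -c) = ((a * b * c : ℕ) : ℤ) by rw [hP, hc']; ring,
          Int.natAbs_natCast]
      · rw [hQ, hc']; ring

/-- **B–G 12.5.10 + proof of 12.5.12 (c) ⟹ (a), packaged**: every abc triple `(a, b, c)` carries
a global minimal Weierstrass equation `W₀` over `ℤ` of a Frey curve — (12.17) for `(A, B) = (a, b)`
if `16 ∤ abc`, (12.18) for the arrangement of `exists_arrangement` if `16 ∣ abc` — with
`cond ∣ 2¹⁰ rad (abc)` and `c² ≤ 2 |c₄ (W₀)|` (`c₄ = 16 (a² + ab + b²)`, resp.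
`(a² + b² + c²)/2`). [cite: BombieriGubler2006, Thm. 12.5.12 (c) ⟹ (a)] -/
theorem exists_minimal_frey_model {a b c : ℕ} (h : DiophantineGeometry.IsABCTriple a b c) :
    ∃ W₀ : WeierstrassCurve ℤ, (W₀.baseChange ℚ).IsElliptic ∧
      (∀ v : HeightOneSpectrum ℤ, (W₀.baseChange ℚ).IsMinimalAt v) ∧
      (W₀.baseChange ℚ).conductorNorm ℤ ∣ 2 ^ 10 * DiophantineGeometry.rad a b c ∧
      (c : ℤ) ^ 2 ≤ 2 * |W₀.c₄| := by
  have h' := h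
  obtain ⟨ha, hb, habc, hcop⟩ := h'
  have hc : 0 < c := by omega
  have habc0 : a * b * c ≠ 0 := by positivity
  by_cases h16 : 16 ∣ a * b * c
  · obtain ⟨A, B, hAB, hA, hB, hprod, hquad⟩ := exists_arrangement h h16
    have h0 : A * B * (A + B) ≠ 0 := by
      rw [← Int.natAbs_ne_zero, hprod]; exact habc0
    have h4 : 4 ∣ B - A - 1 := by
      have : B - A - 1 = B - (A + 1) := by ring
      rw [this]; exact dvd_sub (dvd_trans (by norm_num) hB) hA
    have h16' : 16 ∣ A * B := dvd_mul_of_dvd_right hB _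
    refine ⟨freyIntModel₂ A B, isElliptic_freyIntModel₂ h0 h4 h16', isMinimalAt_freyIntModel₂ hAB hA hB,
      ?_, ?_⟩
    · rw [DiophantineGeometry.rad_def, ← hprod]
      exact (conductorNorm_freyIntModel₂_dvd hAB h0 hA hB).trans (dvd_mul_left _ _)
    · rw [freyIntModel₂_c₄ h4 h16']
      have hq : (0 : ℤ) ≤ A ^ 2 + A * B + B ^ 2 := by nlinarith [sq_nonneg (A + B), sq_nonneg A, sq_nonneg B]
      rw [abs_of_nonneg hq, hquad]
      nlinarith [sq_nonneg (a : ℤ), sq_nonneg (b : ℤ)]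
  · have hab : IsCoprime (a : ℤ) (b : ℤ) := Nat.isCoprime_iff_coprime.mpr hcop
    have hP : (a : ℤ) * b * (a + b) = ((a * b * c : ℕ) : ℤ) := by rw [← habc]; push_cast; ring
    have h0 : (a : ℤ) * b * (a + b) ≠ 0 := by rw [hP]; exact_mod_cast habc0
    have h16' : ¬ (16 : ℤ) ∣ (a : ℤ) * b * (a + b) := by
      rw [hP]; exact_mod_cast mt Int.natCast_dvd_natCast.mp h16
    refine ⟨freyIntModel a b, isElliptic_freyIntModel h0, isMinimalAt_freyIntModel hab h0 h16', ?_, ?_⟩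
    · have := conductorNorm_freyIntModel_dvd hab h0 h16'
      rwa [hP, Int.natAbs_natCast, ← DiophantineGeometry.rad_def] at this
    · rw [freyIntModel_c₄]
      have hq : (0 : ℤ) ≤ (a : ℤ) ^ 2 + a * b + b ^ 2 := by positivity
      rw [abs_of_nonneg (by positivity), ← habc]
      push_cast
      nlinarith [hq, sq_nonneg ((a : ℤ) - b)]

/-! ### Bombieri–Gubler, Theorem 12.5.12, (c) ⟹ (a) -/

/-- **Bombieri–Gubler, Theorem 12.5.12, (c) ⟹ (a)** (*Heights in Diophantine Geometry* (2006),
p. 433): the generalized Szpiro conjecture 12.5.11 (`GeneralizedSzpiroConjectureBG`) implies the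
strong abc-conjecture 12.2.2 over `ℚ` (in the printed `≤`-form over Wave0's `IsABCTriple` / `rad`).
Printed proof: for coprime `a + b = c` take the Frey curve `y² = x (x + a) (x − b)` with its
global minimal equation (12.17) or (12.18) (`exists_minimal_frey_model`); the generalized Szpiro
conjecture gives `|c₄|³ ≪_ε cond (E)^{6+ε}` with `c₄ = 16 (a² + ab + b²)` resp. `a² + ab + b²`,
while `cond (E) ≤ 16³ ∏_{p ∣ abc} p` by the computation of the reduction types in Example 12.5.10;
"we easily deduce that `max (|a|, |b|, |c|) ≪_ε rad (abc)^{1+ε}`". (Here: `c⁶ ≤ 8 |c₄|³`,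
Szpiro with `6ε`, and sixth roots.) [cite: BombieriGubler2006, Thm. 12.5.12 (c) ⟹ (a)] -/
theorem abcLe_of_generalizedSzpiroBG (hS : GeneralizedSzpiroConjectureBG) :
    ∀ ε : ℝ, 0 < ε → ∃ C : ℝ, ∀ a b c : ℕ, DiophantineGeometry.IsABCTriple a b c →
      (c : ℝ) ≤ C * ((DiophantineGeometry.rad a b c : ℕ) : ℝ) ^ (1 + ε) := by
  intro ε hε
  obtain ⟨C₁, hC₁⟩ := hS (6 * ε) (by positivity)
  set C : ℝ := max C₁ 1 with hCdef
  have hC0 : 0 < C := one_pos.trans_le (le_max_right _ _)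
  set M : ℝ := 8 * C * ((2 : ℝ) ^ 10) ^ (6 + 6 * ε) with hMdef
  have hM0 : 0 ≤ M := by positivity
  refine ⟨M ^ (1 / 6 : ℝ), fun a b c h ↦ ?_⟩
  obtain ⟨W₀, hE, hmin, hN, hc₄⟩ := exists_minimal_frey_model h
  haveI := hE
  have key := hC₁ W₀ hE hmin
  set N : ℝ := (((W₀.baseChange ℚ).conductorNorm ℤ : ℕ) : ℝ) with hNdef
  set R : ℝ := ((DiophantineGeometry.rad a b c : ℕ) : ℝ) with hRdef
  have hN0 : 0 ≤ N := by positivity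
  have hR0 : 0 ≤ R := by positivity
  have he0 : 0 ≤ 6 + 6 * ε := by positivity
  -- `|c₄|³ ≤ C N^{6+6ε}`
  have h1 : |(W₀.c₄ : ℝ)| ^ 3 ≤ C * N ^ (6 + 6 * ε) := by
    have h := le_of_max_le_right (by simpa [Int.cast_max, Int.cast_abs, Int.cast_pow] using key)
    exact h.trans (mul_le_mul_of_nonneg_right (le_max_left _ _) (by positivity))
  -- `N ≤ 2¹⁰ R`
  have h2 : N ≤ 2 ^ 10 * R := by
    have := Nat.le_of_dvd (mul_pos (by positivity) (by rw [DiophantineGeometry.rad_def]; exact Nat.radical_pos _)) hN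
    rw [hNdef, hRdef]; exact_mod_cast this
  -- `c⁶ ≤ 8 |c₄|³ ≤ M R^{6+6ε}`
  have h3 : (c : ℝ) ^ 6 ≤ M * R ^ (6 + 6 * ε) := by
    have hc2 : (c : ℝ) ^ 2 ≤ 2 * |(W₀.c₄ : ℝ)| := by exact_mod_cast hc₄
    calc (c : ℝ) ^ 6 = ((c : ℝ) ^ 2) ^ 3 := by ring
      _ ≤ (2 * |(W₀.c₄ : ℝ)|) ^ 3 := pow_le_pow_left₀ (by positivity) hc2 3
      _ = 8 * |(W₀.c₄ : ℝ)| ^ 3 := by ring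
      _ ≤ 8 * (C * N ^ (6 + 6 * ε)) := by linarith
      _ ≤ 8 * (C * (2 ^ 10 * R) ^ (6 + 6 * ε)) := by
          gcongr
      _ = M * R ^ (6 + 6 * ε) := by
          rw [hMdef, Real.mul_rpow (by positivity) hR0]; ring
  -- sixth roots
  have h4 := Real.rpow_le_rpow (by positivity) h3 (by norm_num : (0 : ℝ) ≤ 1 / 6)
  rw [← Real.rpow_natCast (c : ℝ) 6, ← Real.rpow_mul (by positivity), Real.mul_rpow hM0 (by positivity),
    ← Real.rpow_mul hR0] at h4
  norm_num at h4
  rwa [show (6 + 6 * ε) * (1 / 6) = 1 + ε by ring] at h4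

end Literature.NumberTheory.EllipticCurves
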